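import Literature.NumberTheory.GelbartRogawski1991.LocalUnitarySplittingDatum
import Literature.NumberTheory.Automorphic.QuadraticLocalBaseChange
import HarnessLib

/-!
# The Galois conjugation `g ↦ ḡ` of the local unitary group and the symplectic embedding: `ι_{−δ}(ḡ) = ι_δ(g)`

Topic `NumberTheory/GelbartRogawski1991`; namespaces `Literature.NumberTheory.Automorphic.UnitaryGroup` (§1–§3, the home of
★ `«local»`, `localPi`, `conjLocal`, `localToSymplectic`) and `Literature.NumberTheory.GelbartRogawski1991.UnitaryDualPair.LocalSplitting`
(§4–§5, the home of ★ `iota`).  KERNEL mathematics: three definitions WITH BODIES (the conjugation homomorphisms, §1–§2) +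
theorems; no named fact, no `sorry`, no instance, no notation.  Cell `hodgecm-mathlib` (D-0151), programme P5 (crux HLiu418 =
stmt-HodgeConjecture-24832), the «(bar) stone» of the census memo `F0/P5/A-p18/g23/CENSUS-L4if-inhouse-road.A-p18g23.md` §2 (A-p18
(g23), 2026-08-31; desk F0P5-plan (g4) «=» 2026-08-31T20:25:33Z): the first of the three explicit transports ((bar), (conj),
(Ad g₀)) behind an in-house road for the last local letter L4if `LemD1RankTwoCMLetters.LemD1_4IfAsPrintedNonsplitCM₂` of #74.

THE MATHEMATICS ([MoeglinVignerasWaldspurger1987, Chap. 1 I.17]: `U(V) ⊂ Sp(Res_{E/F} V)`; [GelbartRogawski1991, §3.1 p. 454]).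
Let `E/F` be a quadratic extension of number fields with non-trivial automorphism `c`, `δ ∈ E` with `c δ = −δ ≠ 0`,
`δ² = d ∈ F`, `v` a finite place of `F`, `E_v = E ⊗_F F_v` (tree `UnitaryGroup.LocalRing E v`) with `c ⊗ 1` (tree `conjLocal`),
`T ∈ Sym_N(F)` invertible, `J = T ⊗ 1`, and `U = U(J)(F_v) = {g ∈ GL_N(E_v) : ḡᵀ J g = J}` (tree `«local» E c N J v`, factor form
`localPi`).  The tree embeds `U` into `Sp(F_vᴺ × F_vᴺ, alt (polar β_T))` through the `F`-rational polarisation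
`E_vᴺ = F_vᴺ·1 ⊕ F_vᴺ·δ` (★ `localToSymplectic … hcδ hδ hd hT hJ`, ★ `localPiToSymplectic`, ★ `iota`): `ι_δ(g)` is `g` read in
the real coordinates `(re_δ, im_δ)` of `quadraticLocalEquiv … hcδ hδ` (★ `localToSymplectic_reIm`).
* §1 Since `J` has entries in `F_v`, ENTRYWISE CONJUGATION `g ↦ ḡ` is an automorphism of `U` (generic: of `U(σ, J)(R)` whenever
  `σ(J) = J`; `unitaryGroupOfFormGalConj`, `localGalConj`, `localPiGalConj`), involutive (`…_apply_apply` from ★ `conjLocal_conjLocal`).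
* §3 The SAME symplectic space carries the coordinates of `−δ` (`c(−δ) = −(−δ)`, `(−δ)² = d`): `Ψ_{−δ}(a, b) = a + b(−δ) = Ψ_δ(a, −b)
  = conj(Ψ_δ(a, b))` (★ `conjLocal_quadraticLocalEquiv`), i.e. **`reIm_{−δ}(x̄) = reIm_δ(x)`** (`reIm_neg_conjLocal`): conjugating
  a vector and passing from `δ` to `−δ` leaves its real coordinates unchanged.
* §4 Hence **`ι_{−δ}(ḡ) = ι_δ(g)`** in `Sp(F_vᴺ × F_vᴺ)` for every `g ∈ U` (`localToSymplectic_galConj`, `localPiToSymplectic_galConj`,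
  `iota_neg_galConj`): both sides send `reIm_δ(x) = reIm_{−δ}(x̄)` to `reIm_δ(g x) = reIm_{−δ}(ḡ x̄)`.
* §5 Consequently a section `s` of the local metaplectic group over `ι_δ` (`proj ∘ s = ι_δ`, the datum of every local Weil
  representation `ω_s` of the tree) yields the section `s ∘ (g ↦ ḡ)` over `ι_{−δ}` (`proj_comp_localPiGalConj`): the representation
  `g ↦ ω_s(ḡ)` of `U` IS a local Weil representation of the SAME hermitian space for the trace-zero element `−δ` — by ★
  `LocalLineModelTransport` («`(a•T_V, δ) ≅ (T_V, δ/a)`» at `a = −1`) a line-`(−a)` object.  This is the (bar) leg of the memo's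
  transport group; no representation theory is used here.
HONEST LABEL: nothing of the cited sources is asserted; HC_CM is proved only modulo the printed citations until rung 0 closes.

## References
* [MoeglinVignerasWaldspurger1987] C. Mœglin, M.-F. Vignéras, J.-L. Waldspurger, *Correspondances de Howe sur un corps p-adique*,
  LNM 1291 (1987), Chap. 1 I.17 (unitary groups inside the symplectic group of the restriction of scalars), Chap. 2 II.1.
* [GelbartRogawski1991] S. Gelbart, J. Rogawski, *L-functions and Fourier–Jacobi coefficients for the unitary group U(3)*,
  Invent. Math. 105 (1991), §3.1 p. 454 («`s(G(F)) ⊂ i(Sp_F(W))`»).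
* [CasselsFrohlichANT1967] J. W. S. Cassels, A. Fröhlich (eds.), *Algebraic Number Theory* (1967), Ch. II §10 (`L ⊗_K K_v`).
-/

set_option autoImplicit false

noncomputable section

open NumberField IsDedekindDomain Matrix
open Literature.RepresentationTheory.HeisenbergGroup
open Literature.NumberTheory.Automorphic

/-! ## §1 Entrywise `σ` is an automorphism of `U(σ, J)(R)` when `σ(J) = J` -/

namespace Literature.NumberTheory.Automorphic

section Generic

variable {R : Type*} [CommRing R] {n : Type*} [Fintype n] [DecidableEq n] (σ : R →+* R) {J : Matrix n n R}

/-- **Entrywise `σ` on `U(σ, J)(R)`** for a `σ`-fixed form matrix `J` (`σ(J) = J`): `g ↦ σ(g)` (entrywise) is a group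
endomorphism of `U(σ, J)(R) = {g : σ(g)ᵀ J g = J}` — apply `σ` to the defining equation (★ `map_mem_unitaryGroupOfForm` at
`f = σ`).  For `R = E ⊗_F F_v`, `σ = c ⊗ 1`, `J = T ⊗ 1` this is `g ↦ ḡ` on `U(J)(F_v)`. [cite: MoeglinVignerasWaldspurger1987, Chap. 1 I.17] -/
def unitaryGroupOfFormGalConj (hJ : J.map σ = J) : unitaryGroupOfForm σ J →* unitaryGroupOfForm σ J where
  toFun g := ⟨Matrix.GeneralLinearGroup.map σ (g : GL n R), by
    simpa only [hJ] using map_mem_unitaryGroupOfForm (σ := σ) (τ := σ) σ (fun _ => rfl) g.2⟩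
  map_one' := Subtype.ext (map_one _)
  map_mul' g h := Subtype.ext (map_mul _ _ _)

/-- Underlying invertible matrix of `σ(g)`: `GeneralLinearGroup.map σ g`. [cite: MoeglinVignerasWaldspurger1987, Chap. 1 I.17] -/
@[simp] theorem coe_unitaryGroupOfFormGalConj (hJ : J.map σ = J) (g : unitaryGroupOfForm σ J) :
    ((unitaryGroupOfFormGalConj σ hJ g : unitaryGroupOfForm σ J) : GL n R) = Matrix.GeneralLinearGroup.map σ (g : GL n R) := rfl

/-- Underlying matrix of `σ(g)`: `σ` applied entrywise. [cite: MoeglinVignerasWaldspurger1987, Chap. 1 I.17] -/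
theorem val_unitaryGroupOfFormGalConj (hJ : J.map σ = J) (g : unitaryGroupOfForm σ J) :
    (((unitaryGroupOfFormGalConj σ hJ g : unitaryGroupOfForm σ J) : GL n R) : Matrix n n R) = ((g : GL n R) : Matrix n n R).map σ :=
  rfl

/-- For an involutive `σ`, `g ↦ σ(g)` is involutive on `U(σ, J)(R)`. [cite: MoeglinVignerasWaldspurger1987, Chap. 1 I.17] -/
theorem unitaryGroupOfFormGalConj_apply_apply (hJ : J.map σ = J) (hσ : ∀ x, σ (σ x) = x) (g : unitaryGroupOfForm σ J) :
    unitaryGroupOfFormGalConj σ hJ (unitaryGroupOfFormGalConj σ hJ g) = g := by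
  refine Subtype.ext (Units.ext ?_)
  rw [val_unitaryGroupOfFormGalConj, val_unitaryGroupOfFormGalConj, Matrix.map_map]
  conv_rhs => rw [← Matrix.map_id ((g : GL n R) : Matrix n n R)]
  exact congrArg _ (funext hσ)

end Generic

/-! ## §2 `g ↦ ḡ` on `U(J)(F_v)` (`«local»`) and on its factor form `localPi` -/

namespace UnitaryGroup

variable {F : Type} (E : Type) [Field F] [NumberField F] [Field E] [NumberField E] [Algebra F E]
variable (c : E ≃ₐ[F] E) (N : ℕ) {T : Matrix (Fin N) (Fin N) F} {J : Matrix (Fin N) (Fin N) E}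

/-- The local form matrix of `J = T ⊗ 1` is fixed by `c ⊗ 1` (its entries lie in `ι_v(F_v)`).
[cite: CasselsFrohlichANT1967, Ch. II §10] -/
theorem localForm_map_conjLocal (v : HeightOneSpectrum (𝓞 F)) (hJ : J = T.map (algebraMap F E)) :
    ((adelicForm E N J).map (adeleToLocal E v)).map (conjLocal E c v) = (adelicForm E N J).map (adeleToLocal E v) := by
  rw [localForm_eq_map E N v T hJ, Matrix.map_map, Matrix.map_map]
  exact congrArg _ (funext fun t => conjLocal_toLocalRing c v _)

/-- **`g ↦ ḡ` on `U(J)(F_v)`** (`J = T ⊗ 1`, `T ∈ M_N(F)`): entrywise `c ⊗ 1`, a group endomorphism of ★ `«local» E c N J v`.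
[cite: MoeglinVignerasWaldspurger1987, Chap. 1 I.17] -/
def localGalConj (v : HeightOneSpectrum (𝓞 F)) (hJ : J = T.map (algebraMap F E)) : «local» E c N J v →* «local» E c N J v :=
  unitaryGroupOfFormGalConj (conjLocal E c v) (localForm_map_conjLocal E c N v hJ)

/-- Underlying matrix of `ḡ`: `c ⊗ 1` entrywise. [cite: MoeglinVignerasWaldspurger1987, Chap. 1 I.17] -/
@[simp] theorem val_localGalConj (v : HeightOneSpectrum (𝓞 F)) (hJ : J = T.map (algebraMap F E)) (g : «local» E c N J v) :
    (localGalConj E c N v hJ g).1.1 = g.1.1.map (conjLocal E c v) :=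
  rfl

/-- `(c ⊗ 1) ∘ (c ⊗ 1) = id` on `E_v` (private copy of ★ `conjLocal_conjLocal`, kept import-light: in the coordinates of
`quadraticLocalEquiv`, `c ⊗ 1` is `(a, b) ↦ (a, −b)`). [cite: CasselsFrohlichANT1967, Ch. II §10] -/
private theorem conjLocal_conjLocal' [Algebra.IsQuadraticExtension F E] (v : HeightOneSpectrum (𝓞 F)) {δ : E} (hcδ : c δ = -δ)
    (hδ : δ ≠ 0) (x : LocalRing E v) : conjLocal E c v (conjLocal E c v x) = x := by
  obtain ⟨⟨a, b⟩, rfl⟩ := (quadraticLocalEquiv E v c hcδ hδ).surjective x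
  rw [conjLocal_quadraticLocalEquiv, conjLocal_quadraticLocalEquiv, neg_neg]

/-- `ḡ` acts on vectors by `ḡ x̄ = conj(g x)`: `(c ⊗ 1)` is a ring homomorphism. [cite: MoeglinVignerasWaldspurger1987, Chap. 1 I.17] -/
theorem localGalConj_mulVec_conj (v : HeightOneSpectrum (𝓞 F)) (hJ : J = T.map (algebraMap F E)) (g : «local» E c N J v)
    (x : Fin N → LocalRing E v) :
    (localGalConj E c N v hJ g).1.1 *ᵥ (fun i => conjLocal E c v (x i)) = fun i => conjLocal E c v ((g.1.1 *ᵥ x) i) := by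
  rw [val_localGalConj]
  exact funext fun i => (RingHom.map_mulVec (conjLocal E c v) _ x i).symm

/-- `g ↦ ḡ` is involutive on `U(J)(F_v)` (quadratic `E/F`: `(c ⊗ 1)² = 1`, ★ `conjLocal_conjLocal_apply`).
[cite: CasselsFrohlichANT1967, Ch. II §10] -/
theorem localGalConj_localGalConj [Algebra.IsQuadraticExtension F E] (v : HeightOneSpectrum (𝓞 F)) {δ : E} (hcδ : c δ = -δ)
    (hδ : δ ≠ 0) (hJ : J = T.map (algebraMap F E)) (g : «local» E c N J v) :
    localGalConj E c N v hJ (localGalConj E c N v hJ g) = g :=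
  unitaryGroupOfFormGalConj_apply_apply (conjLocal E c v) (localForm_map_conjLocal E c N v hJ)
    (conjLocal_conjLocal' E c v hcδ hδ) g

/-- **`g ↦ ḡ` on the factor form `localPi`** of `U(J)(F_v)` (transport of `localGalConj` along ★ `localPiEquiv`).
[cite: MoeglinVignerasWaldspurger1987, Chap. 1 I.17] -/
def localPiGalConj (v : HeightOneSpectrum (𝓞 F)) (hJ : J = T.map (algebraMap F E)) : localPi E c N J v →* localPi E c N J v where
  toFun u := (localPiEquiv E c N J v).symm (localGalConj E c N v hJ (localPiEquiv E c N J v u))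
  map_one' := by rw [map_one, map_one, map_one]
  map_mul' a b := by rw [map_mul, map_mul, map_mul]

/-- `localPiEquiv` intertwines the two conjugations (definitional). [cite: MoeglinVignerasWaldspurger1987, Chap. 1 I.17] -/
theorem localPiEquiv_localPiGalConj (v : HeightOneSpectrum (𝓞 F)) (hJ : J = T.map (algebraMap F E)) (u : localPi E c N J v) :
    localPiEquiv E c N J v (localPiGalConj E c N v hJ u) = localGalConj E c N v hJ (localPiEquiv E c N J v u) :=
  (localPiEquiv E c N J v).apply_symm_apply _

/-- `g ↦ ḡ` is involutive on `localPi`. [cite: CasselsFrohlichANT1967, Ch. II §10] -/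
theorem localPiGalConj_localPiGalConj [Algebra.IsQuadraticExtension F E] (v : HeightOneSpectrum (𝓞 F)) {δ : E} (hcδ : c δ = -δ)
    (hδ : δ ≠ 0) (hJ : J = T.map (algebraMap F E)) (u : localPi E c N J v) :
    localPiGalConj E c N v hJ (localPiGalConj E c N v hJ u) = u := by
  apply (localPiEquiv E c N J v).injective
  rw [localPiEquiv_localPiGalConj, localPiEquiv_localPiGalConj, localGalConj_localGalConj E c N v hcδ hδ hJ]

/-! ## §3 The real coordinates of `−δ`: `reIm_{−δ}(x̄) = reIm_δ(x)` -/

/-- `Ψ_{−δ}(a, b) = a + b·(−δ) = Ψ_δ(a, −b)`. [cite: CasselsFrohlichANT1967, Ch. II §10] -/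
theorem quadraticLocalEquiv_neg_apply [Algebra.IsQuadraticExtension F E] (v : HeightOneSpectrum (𝓞 F)) {δ : E} (hcδ : c δ = -δ)
    (hδ : δ ≠ 0) (hcδ' : c (-δ) = -(-δ)) (hδ' : -δ ≠ 0) (a b : v.adicCompletion F) :
    quadraticLocalEquiv E v c hcδ' hδ' (a, b) = quadraticLocalEquiv E v c hcδ hδ (a, -b) := by
  rw [quadraticLocalEquiv_apply, quadraticLocalEquiv_apply, map_neg, map_neg]
  ring

/-- `Ψ_{−δ}(a, b) = conj (Ψ_δ(a, b))`: the `−δ`-coordinates of `x̄` are the `δ`-coordinates of `x`. [cite: CasselsFrohlichANT1967, Ch. II §10] -/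
theorem quadraticLocalEquiv_neg_eq_conjLocal [Algebra.IsQuadraticExtension F E] (v : HeightOneSpectrum (𝓞 F)) {δ : E}
    (hcδ : c δ = -δ) (hδ : δ ≠ 0) (hcδ' : c (-δ) = -(-δ)) (hδ' : -δ ≠ 0) (p : v.adicCompletion F × v.adicCompletion F) :
    quadraticLocalEquiv E v c hcδ' hδ' p = conjLocal E c v (quadraticLocalEquiv E v c hcδ hδ p) := by
  obtain ⟨a, b⟩ := p
  rw [quadraticLocalEquiv_neg_apply E c v hcδ hδ hcδ' hδ', conjLocal_quadraticLocalEquiv]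

/-- **`reIm_{−δ}(x̄) = reIm_δ(x)`** on `E_vᴺ`: conjugating a vector and replacing `δ` by `−δ` leaves its coordinates in the
`F`-rational polarisation `F_vᴺ·1 ⊕ F_vᴺ·δ` unchanged. [cite: MoeglinVignerasWaldspurger1987, Chap. 1 I.17] -/
theorem reIm_neg_conjLocal [Algebra.IsQuadraticExtension F E] (v : HeightOneSpectrum (𝓞 F)) {δ : E} (hcδ : c δ = -δ) (hδ : δ ≠ 0)
    (hcδ' : c (-δ) = -(-δ)) (hδ' : -δ ≠ 0) (x : Fin N → LocalRing E v) :
    QuadraticCoordinates.reIm (quadraticLocalEquiv E v c hcδ' hδ').toLinearEquiv.toAddEquiv (Fin N) (fun i => conjLocal E c v (x i)) =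
      QuadraticCoordinates.reIm (quadraticLocalEquiv E v c hcδ hδ).toLinearEquiv.toAddEquiv (Fin N) x := by
  set Ψ := (quadraticLocalEquiv E v c hcδ hδ).toLinearEquiv.toAddEquiv with hΨ
  set Ψ' := (quadraticLocalEquiv E v c hcδ' hδ').toLinearEquiv.toAddEquiv with hΨ'
  have hx : (fun i => conjLocal E c v (x i)) =
      (QuadraticCoordinates.reIm Ψ' (Fin N)).symm (QuadraticCoordinates.reIm Ψ (Fin N) x) := by
    funext i
    rw [QuadraticCoordinates.reIm_symm_apply, QuadraticCoordinates.reIm_apply_fst, QuadraticCoordinates.reIm_apply_snd]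
    have h1 : Ψ' (QuadraticCoordinates.re Ψ (x i), QuadraticCoordinates.im Ψ (x i)) =
        conjLocal E c v (Ψ (QuadraticCoordinates.re Ψ (x i), QuadraticCoordinates.im Ψ (x i))) :=
      quadraticLocalEquiv_neg_eq_conjLocal E c v hcδ hδ hcδ' hδ' _
    rw [h1, QuadraticCoordinates.apply_re_im]
  rw [hx, AddEquiv.apply_symm_apply]

/-! ## §4 `ι_{−δ}(ḡ) = ι_δ(g)` -/

/-- **`ι_{−δ}(ḡ) = ι_δ(g)` in `Sp(F_vᴺ × F_vᴺ, alt (polar β_T))`** for every `g ∈ U(J)(F_v)`: the symplectic embedding built on the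
coordinates of `−δ`, evaluated at the conjugate `ḡ`, IS the embedding built on `δ` evaluated at `g` — both send `reIm_δ(x) = reIm_{−δ}(x̄)`
to `reIm_δ(g x) = reIm_{−δ}(ḡ x̄)` (★ `localToSymplectic_reIm`). [cite: MoeglinVignerasWaldspurger1987, Chap. 1 I.17] -/
theorem localToSymplectic_galConj [Algebra.IsQuadraticExtension F E] (v : HeightOneSpectrum (𝓞 F)) {δ : E} (hcδ : c δ = -δ)
    (hδ : δ ≠ 0) {d : F} (hd : δ * δ = algebraMap F E d) (hcδ' : c (-δ) = -(-δ)) (hδ' : -δ ≠ 0) (hd' : -δ * -δ = algebraMap F E d)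
    (hT : T.IsSymm) (hJ : J = T.map (algebraMap F E)) (g : «local» E c N J v) :
    localToSymplectic E c N v hcδ' hδ' hd' hT hJ (localGalConj E c N v hJ g) = localToSymplectic E c N v hcδ hδ hd hT hJ g := by
  refine Subtype.ext (LinearEquiv.ext fun w => ?_)
  obtain ⟨x, rfl⟩ := (QuadraticCoordinates.reIm (quadraticLocalEquiv E v c hcδ hδ).toLinearEquiv.toAddEquiv (Fin N)).surjective w
  change (localToSymplectic E c N v hcδ' hδ' hd' hT hJ (localGalConj E c N v hJ g)).1 _ =
    (localToSymplectic E c N v hcδ hδ hd hT hJ g).1 _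
  rw [localToSymplectic_reIm, ← reIm_neg_conjLocal E c N v hcδ hδ hcδ' hδ', localToSymplectic_reIm,
    localGalConj_mulVec_conj, reIm_neg_conjLocal E c N v hcδ hδ hcδ' hδ']

/-- `ι_{−δ}(ḡ) = ι_δ(g)` on the factor form `localPi` (★ `localPiToSymplectic`). [cite: MoeglinVignerasWaldspurger1987, Chap. 1 I.17] -/
theorem localPiToSymplectic_galConj [Algebra.IsQuadraticExtension F E] (v : HeightOneSpectrum (𝓞 F)) {δ : E} (hcδ : c δ = -δ)
    (hδ : δ ≠ 0) {d : F} (hd : δ * δ = algebraMap F E d) (hcδ' : c (-δ) = -(-δ)) (hδ' : -δ ≠ 0) (hd' : -δ * -δ = algebraMap F E d)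
    (hT : T.IsSymm) (hJ : J = T.map (algebraMap F E)) (u : localPi E c N J v) :
    localPiToSymplectic E c N v hcδ' hδ' hd' hT hJ (localPiGalConj E c N v hJ u) = localPiToSymplectic E c N v hcδ hδ hd hT hJ u := by
  change localToSymplectic E c N v hcδ' hδ' hd' hT hJ (localPiEquiv E c N J v (localPiGalConj E c N v hJ u)) =
    localToSymplectic E c N v hcδ hδ hd hT hJ (localPiEquiv E c N J v u)
  rw [localPiEquiv_localPiGalConj, localToSymplectic_galConj E c N v hcδ hδ hd hcδ' hδ' hd' hT hJ]

end UnitaryGroup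

end Literature.NumberTheory.Automorphic

/-! ## §5 `ι_{−δ}(ḡ) = ι_δ(g)` for the splitting files' `iota`, and sections over `ι_{−δ}` from sections over `ι_δ` -/

namespace Literature.NumberTheory.GelbartRogawski1991.UnitaryDualPair.LocalSplitting

open Literature.NumberTheory.Automorphic.UnitaryGroup

variable (F : Type) [Field F] [NumberField F] (E : Type) [Field E] [NumberField E] [Algebra F E]
  [Algebra.IsQuadraticExtension F E] (c : E ≃ₐ[F] E) (N : ℕ)
  {δ : E} (hcδ : c δ = -δ) (hδ : δ ≠ 0) {d : F} (hd : δ * δ = algebraMap F E d)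
  (hcδ' : c (-δ) = -(-δ)) (hδ' : -δ ≠ 0) (hd' : -δ * -δ = algebraMap F E d)
  (T : Matrix (Fin N) (Fin N) F) (hT : T.IsSymm) {J : Matrix (Fin N) (Fin N) E} (hJ : J = T.map (algebraMap F E))
  (v : HeightOneSpectrum (𝓞 F))

/-- **`ι_{−δ}(ḡ) = ι_δ(g)`** for the local embedding `iota` of the splitting files (★ `iota_def`).
[cite: MoeglinVignerasWaldspurger1987, Chap. 1 I.17] -/
theorem iota_neg_galConj (u : localPi E c N J v) :
    iota F E c N hcδ' hδ' hd' T hT hJ v (localPiGalConj E c N v hJ u) = iota F E c N hcδ hδ hd T hT hJ v u := by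
  rw [iota_def, iota_def]
  exact localPiToSymplectic_galConj E c N v hcδ hδ hd hcδ' hδ' hd' hT hJ u

/-- … equivalently `ι_{−δ}(g) = ι_δ(ḡ)` (the conjugation is an involution). [cite: MoeglinVignerasWaldspurger1987, Chap. 1 I.17] -/
theorem iota_neg_eq_iota_galConj (u : localPi E c N J v) :
    iota F E c N hcδ' hδ' hd' T hT hJ v u = iota F E c N hcδ hδ hd T hT hJ v (localPiGalConj E c N v hJ u) := by
  rw [← iota_neg_galConj F E c N hcδ hδ hd hcδ' hδ' hd' T hT hJ v (localPiGalConj E c N v hJ u),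
    localPiGalConj_localPiGalConj E c N v hcδ hδ hJ]

/-- **Sections over `ι_{−δ}` from sections over `ι_δ`.**  If `s : U(J)(F_v) → S̃p_{ψ_v}(𝕎_v)` is a homomorphism over `ι_δ`
(`proj ∘ s = ι_δ` — the datum of every local Weil representation `ω_s` of the tree), then `s ∘ (g ↦ ḡ)` is a homomorphism over
`ι_{−δ}`; its Weil representation is `g ↦ ω_s(ḡ)` by definition.  (By ★ `LocalLineModelTransport` the trace-zero element `−δ` at the
line `a` is the element `δ` at the line `−a`.) [cite: MoeglinVignerasWaldspurger1987, Chap. 2 II.1 (B)] -/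
theorem proj_comp_localPiGalConj (s : localPi E c N J v →* LocalMp F N T v)
    (hs : ∀ g, MpPsi.proj _ (s g) = iota F E c N hcδ hδ hd T hT hJ v g) (g : localPi E c N J v) :
    MpPsi.proj _ ((s.comp (localPiGalConj E c N v hJ)) g) = iota F E c N hcδ' hδ' hd' T hT hJ v g := by
  rw [MonoidHom.comp_apply, hs, ← iota_neg_eq_iota_galConj F E c N hcδ hδ hd hcδ' hδ' hd' T hT hJ v]

omit [Algebra.IsQuadraticExtension F E] in
/-- The Weil representation of the conjugated section is `g ↦ ω_s(ḡ)` (definitional bookkeeping for consumers).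
[cite: MoeglinVignerasWaldspurger1987, Chap. 2 II.1 (B)] -/
theorem toRep_comp_comp_localPiGalConj_apply (s : localPi E c N J v →* LocalMp F N T v) (g : localPi E c N J v) :
    (MpPsi.toRep (localSchrodinger F N T v)).comp (s.comp (localPiGalConj E c N v hJ)) g =
      (MpPsi.toRep (localSchrodinger F N T v)).comp s (localPiGalConj E c N v hJ g) := rfl

end Literature.NumberTheory.GelbartRogawski1991.UnitaryDualPair.LocalSplitting

end
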